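import Mathlib
import Summits.PneNP.PneNP.Theses.OneSlice
import Summits.PneNP.PneNP.Theorems.OneSliceSliceTargetSplit
import Summits.PneNP.PneNP.Theorems.OneSliceMonotoneContinuationPadMixture

/-!
# Route OneSlice, crux `MonotoneContinuation` (stmt-PneNP-18471), line `Sketch_ideator1_r1` (ProfileLine)
# — stub `padFibre_sum`

The landing-level law of uniform-size padding, exactly normalised (bridge `MC → flat-above`, U1).
Fix an edge vector `x` at level `e(x) = i`, a target level `s = i + l ≤ N := C(n,2)` and write
`N - i = l + m`. Padding `x` by a `ρ` of the slice `a` lands at level `e(x ∨ ρ) = i + #(supp ρ ∖ supp x)`,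
so the landing fibre `{ρ ∈ slice n a : e(x ∨ ρ) = s}` is empty for `a < l`, and for `a = l + t` it is in
bijection with the pairs (an `l`-subset of `(supp x)ᶜ`, a `t`-subset of `supp x`): it has
`C(N - i, l)·C(i, t)` elements, while `#slice n a = C(N, a)`. Summing the landing probabilities over all
sizes, the factorial rearrangement `C(l+m,l) C(t+k,t) C(N,t+k) = C(l+t,l) C(m+k,m) C(N,l+t)` (`t + k = i`;
both sides are `N!/(l! m! t! k!)`) turns `Σ_t C(l+m,l) C(i,t)/C(N,l+t)` into
`(Σ_{t+k=i} C(l+t,l) C(m+k,m)) / C(N,i)`; the numerator is the upper Chu–Vandermonde convolution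
`C(l+m+1+i, l+m+1) = C(N+1, i)` (the coefficient of `X^i` in `(1-X)^{-(l+1)}·(1-X)^{-(m+1)} = (1-X)^{-(l+m+2)}`,
read off Mathlib's `PowerSeries.mk_one_pow_eq_mk_choose_add`), and `C(N+1,i)/C(N,i) = (N+1)/(N-i+1)`.
-/

set_option linter.dupNamespace false -- `Summit.PneNP.PneNP.…`: summit = sub-problem (D-0017)

namespace Summit.PneNP.PneNP.Theorems.MonotoneContinuation

open Literature.Computability.Complexity hiding supp mem_supp
open Finset hiding slice
open Filter hiding mem_sdiff
open Classical
open Summit.PneNP.PneNP.Theorems (binomialWeight_tail_le binomialWeight_sum_range binomialWeight_nonneg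
  binomialWeight_variance card_slice)
open Summit.PneNP.PneNP.Theorems.ConstantBand.Negative (Edge thr Central slice)
open Summit.PneNP.PneNP.Theorems.SingleThreshold.Negative (pc)
open Summit.PneNP.PneNP.Theorems.SliceACZero.Negative (supp mem_supp card_supp supp_injective supp_indicator)
open Summit.PneNP.PneNP.Theorems.SliceTargetSplit (Comp nbhd mem_nbhd transport ind l1 nbhdCard card_nbhd
  card_nbhd_of_le card_nbhd_of_ge choose_mul_nbhdCard nbhdCard_pos sum_slice_sum_nbhd sum_slice_sum_nbhd_left
  supp_subset_of_comp_of_le comp_iff_supp comp_comm ofSet supp_ofSet ofSet_supp edgeCount_ofSet ind_nonneg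
  ind_le_one abs_ind_sub_ind l1_triangle l1_comm l1_nonneg transport_nonneg transport_sub)

noncomputable section

variable {n : ℕ}

/-! ### Levels of joins -/

/-- The level of a join: `e(x ∨ ρ) = e(x) + #(supp ρ ∖ supp x)` (the support of the join is `supp x ∪ supp ρ`,
`padMixture_supp_join`). [folklore] -/
theorem padFibre_edgeCount_or (x ρ : Edge n → Bool) :
    edgeCount (fun e => x e || ρ e) = edgeCount x + #(supp ρ \ supp x) := by
  rw [← card_supp, ← card_supp, padMixture_supp_join, add_comm, card_sdiff_add_card, union_comm]

/-! ### The landing fibres of uniform-size padding -/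

/-- **Landing fibre count.** For `e(x) = i`, the vectors `ρ` of the slice `l + t` with `e(x ∨ ρ) = i + l`
are in bijection with the pairs (an `l`-subset of `(supp x)ᶜ`, a `t`-subset of `supp x`), via
`ρ ↦ (supp ρ ∖ supp x, supp ρ ∩ supp x)`; hence there are `C(C(n,2) - i, l)·C(i, t)` of them. [folklore] -/
theorem padFibre_card_fibre {x : Edge n → Bool} {i : ℕ} (hx : edgeCount x = i) (l t : ℕ) :
    #((slice n (l + t)).filter fun ρ => edgeCount (fun e => x e || ρ e) = i + l) =
      (n.choose 2 - i).choose l * i.choose t := by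
  have hc : #((supp x)ᶜ) = n.choose 2 - i := by
    rw [card_compl, card_edgeSet_top_fin, card_supp, hx]
  have hi : #(supp x) = i := by rw [card_supp, hx]
  calc #((slice n (l + t)).filter fun ρ => edgeCount (fun e => x e || ρ e) = i + l)
      = #((powersetCard l (supp x)ᶜ) ×ˢ (powersetCard t (supp x))) := ?_
    _ = (n.choose 2 - i).choose l * i.choose t := by
        rw [card_product, card_powersetCard, card_powersetCard, hc, hi]
  refine card_nbij' (fun ρ => (supp ρ \ supp x, supp ρ ∩ supp x)) (fun p => ofSet (p.1 ∪ p.2)) ?_ ?_ ?_ ?_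
  · intro ρ hρ
    rw [mem_coe, mem_filter, padFibre_edgeCount_or, hx] at hρ
    have hρa : edgeCount ρ = l + t := (mem_filter.1 hρ.1).2
    have h1 : #(supp ρ \ supp x) = l := by omega
    have h2 : #(supp ρ ∩ supp x) = t := by
      have h12 := card_sdiff_add_card_inter (supp ρ) (supp x)
      rw [card_supp, hρa] at h12
      omega
    rw [mem_coe, mem_product, mem_powersetCard, mem_powersetCard]
    exact ⟨⟨fun e he => mem_compl.2 (mem_sdiff.1 he).2, h1⟩, ⟨inter_subset_right, h2⟩⟩
  · intro p hp
    rw [mem_coe, mem_product, mem_powersetCard, mem_powersetCard] at hp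
    have hdisj : Disjoint p.1 (supp x) :=
      Finset.disjoint_left.2 fun e he hex => (mem_compl.1 (hp.1.1 he)) hex
    have hdisj12 : Disjoint p.1 p.2 := hdisj.mono_right hp.2.1
    rw [mem_coe, mem_filter, padFibre_edgeCount_or, hx, supp_ofSet, union_sdiff_distrib,
      sdiff_eq_self_of_disjoint hdisj, Finset.sdiff_eq_empty_iff_subset.2 hp.2.1, union_empty, hp.1.2]
    refine ⟨mem_filter.2 ⟨mem_univ _, ?_⟩, rfl⟩
    show edgeCount (ofSet (p.1 ∪ p.2)) = l + t
    rw [edgeCount_ofSet, card_union_of_disjoint hdisj12, hp.1.2, hp.2.2]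
  · intro ρ _
    change ofSet (supp ρ \ supp x ∪ supp ρ ∩ supp x) = ρ
    rw [sdiff_union_inter, ofSet_supp]
  · intro p hp
    rw [mem_coe, mem_product, mem_powersetCard, mem_powersetCard] at hp
    have hdisj : Disjoint p.1 (supp x) :=
      Finset.disjoint_left.2 fun e he hex => (mem_compl.1 (hp.1.1 he)) hex
    change (supp (ofSet (p.1 ∪ p.2)) \ supp x, supp (ofSet (p.1 ∪ p.2)) ∩ supp x) = p
    rw [supp_ofSet, union_sdiff_distrib, sdiff_eq_self_of_disjoint hdisj,
      Finset.sdiff_eq_empty_iff_subset.2 hp.2.1, union_empty, union_inter_distrib_right,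
      Finset.disjoint_iff_inter_eq_empty.1 hdisj, empty_union, Finset.inter_eq_left.2 hp.2.1]

/-- Below the gap no padding lands: for `a < l` the landing fibre at level `e(x) + l` over the slice `a` is
empty (`e(x ∨ ρ) ≤ e(x) + e(ρ)`). [folklore] -/
theorem padFibre_card_fibre_eq_zero {x : Edge n → Bool} {i l a : ℕ} (hx : edgeCount x = i) (ha : a < l) :
    #((slice n a).filter fun ρ => edgeCount (fun e => x e || ρ e) = i + l) = 0 := by
  rw [card_eq_zero, filter_eq_empty_iff]
  intro ρ hρ h
  rw [padFibre_edgeCount_or, hx] at h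
  have h' : #(supp ρ \ supp x) ≤ #(supp ρ) := card_le_card Finset.sdiff_subset
  rw [card_supp, (mem_filter.1 hρ).2] at h'
  omega

/-! ### The binomial identity -/

/-- The factorial rearrangement `C(l+m,l)·C(t+k,t)·C(N,t+k) = C(l+t,l)·C(m+k,m)·C(N,l+t)` for
`N = l + m + t + k` (both sides are `N!/(l! m! t! k!)`). [folklore] -/
theorem padFibre_choose_rearrange (l m t k : ℕ) :
    ((l + m).choose l : ℝ) * ((t + k).choose t) * ((t + k + (l + m)).choose (t + k)) =
      ((l + t).choose l : ℝ) * ((m + k).choose m) * ((l + t + (m + k)).choose (l + t)) := by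
  simp only [Nat.cast_add_choose]
  rw [show t + k + (l + m) = l + t + (m + k) by ring]
  field_simp

/-- Upper Chu–Vandermonde convolution: `Σ_{t ≤ i} C(l+t,l)·C(m+(i-t),m) = C(l+m+1+i, l+m+1)`, the coefficient
of `X^i` in `(1-X)^{-(l+1)}·(1-X)^{-(m+1)} = (1-X)^{-(l+m+2)}`. [folklore] -/
theorem padFibre_upper_vandermonde (l m i : ℕ) :
    ∑ t ∈ range (i + 1), ((l + t).choose l : ℝ) * ((m + (i - t)).choose m) =
      ((l + m + 1 + i).choose (l + m + 1) : ℝ) := by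
  have h : (PowerSeries.mk fun j => (((l + j).choose l : ℕ) : ℝ)) *
      (PowerSeries.mk fun j => (((m + j).choose m : ℕ) : ℝ)) =
      PowerSeries.mk fun j => (((l + m + 1 + j).choose (l + m + 1) : ℕ) : ℝ) := by
    rw [← PowerSeries.mk_one_pow_eq_mk_choose_add, ← PowerSeries.mk_one_pow_eq_mk_choose_add,
      ← PowerSeries.mk_one_pow_eq_mk_choose_add, ← pow_add, show l + 1 + (m + 1) = l + m + 1 + 1 by ring]
  have hi := congrArg (PowerSeries.coeff i) h
  rw [PowerSeries.coeff_mul, Finset.Nat.sum_antidiagonal_eq_sum_range_succ_mk] at hi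
  simpa only [PowerSeries.coeff_mk, Nat.succ_eq_add_one] using hi

/-- The normalised landing law as a pure binomial identity:
`Σ_{t ≤ i} C(l+m,l)·C(i,t) / C(i+l+m, l+t) = (i+l+m+1)/(l+m+1)`. [folklore] -/
theorem padFibre_sum_choose_div (l m i : ℕ) :
    ∑ t ∈ range (i + 1), ((l + m).choose l : ℝ) * (i.choose t) / ((i + l + m).choose (l + t)) =
      (((i + l + m : ℕ) : ℝ) + 1) / (((l + m : ℕ) : ℝ) + 1) := by
  have hterm : ∀ t ∈ range (i + 1), ((l + m).choose l : ℝ) * (i.choose t) / ((i + l + m).choose (l + t)) =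
      ((l + t).choose l : ℝ) * ((m + (i - t)).choose m) / ((i + l + m).choose i) := by
    intro t ht
    obtain ⟨k, rfl⟩ : ∃ k, i = t + k := Nat.exists_eq_add_of_le (Nat.lt_succ_iff.1 (mem_range.1 ht))
    rw [Nat.add_sub_cancel_left, div_eq_div_iff (Nat.cast_ne_zero.2 (Nat.choose_pos (by omega)).ne')
      (Nat.cast_ne_zero.2 (Nat.choose_pos (by omega)).ne')]
    have h := padFibre_choose_rearrange l m t k
    rw [show t + k + (l + m) = t + k + l + m by ring, show l + t + (m + k) = t + k + l + m by ring] at h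
    linarith [h]
  rw [sum_congr rfl hterm, ← sum_div, padFibre_upper_vandermonde,
    div_eq_div_iff (Nat.cast_ne_zero.2 (Nat.choose_pos (by omega)).ne') (by positivity)]
  have hc : (i + l + m).choose i * (l + m + 1 + i) = (l + m + 1 + i).choose (l + m + 1) * (l + m + 1) := by
    have h := Nat.choose_mul_succ_eq (i + l + m) i
    rw [show i + l + m + 1 - i = l + m + 1 by omega, show i + l + m + 1 = l + m + 1 + i by ring,
      ← Nat.choose_symm_add] at h
    exact h
  have hc' : ((i + l + m).choose i : ℝ) * ((l + m + 1 + i : ℕ) : ℝ) =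
      ((l + m + 1 + i).choose (l + m + 1) : ℝ) * ((l + m + 1 : ℕ) : ℝ) := by
    exact_mod_cast hc
  push_cast at hc' ⊢
  linarith [hc']

/-! ### The stub -/

/-- **Landing-level law of uniform-size padding (U1).** For `x` at level `i` and a target level `s` with
`i ≤ s ≤ C(n,2)`, summing over all sizes `a` the fraction of the slice `a` whose join with `x` lands at
level `s` gives exactly `(C(n,2) + 1)/(C(n,2) - i + 1)`: with `s = i + l`, `C(n,2) - i = l + m`, the fibre
over the slice `l + t` has `C(l+m, l)·C(i, t)` of the `C(C(n,2), l+t)` vectors (and is empty below `l`), and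
`Σ_t C(l+m,l) C(i,t)/C(N,l+t) = C(N+1,i)/C(N,i) = (N+1)/(N-i+1)`. [folklore] -/
theorem padFibre_sum :
  ∀ (n i s : ℕ) (x : Edge n → Bool), edgeCount x = i → i ≤ s → s ≤ n.choose 2 →
    ∑ a ∈ range (n.choose 2 + 1),
      (#((slice n a).filter fun ρ => edgeCount (fun e => x e || ρ e) = s) : ℝ) / #(slice n a) =
      ((n.choose 2 : ℝ) + 1) / ((n.choose 2 : ℝ) - i + 1) := by
  intro n i s x hx his hsN
  obtain ⟨l, rfl⟩ := Nat.exists_eq_add_of_le his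
  obtain ⟨m, hm⟩ := Nat.exists_eq_add_of_le hsN
  -- sizes `a < l`: empty fibres
  have h1 : ∑ a ∈ range l,
      (#((slice n a).filter fun ρ => edgeCount (fun e => x e || ρ e) = i + l) : ℝ) / #(slice n a) = 0 := by
    refine sum_eq_zero fun a ha => ?_
    rw [padFibre_card_fibre_eq_zero hx (mem_range.1 ha), Nat.cast_zero, zero_div]
  -- sizes `a = l + t` with `t ≤ i`: the binomial identity
  have h2 : ∀ t ∈ range (i + 1),
      (#((slice n (l + t)).filter fun ρ => edgeCount (fun e => x e || ρ e) = i + l) : ℝ) / #(slice n (l + t)) =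
        ((l + m).choose l : ℝ) * (i.choose t) / ((i + l + m).choose (l + t)) := by
    intro t _
    rw [padFibre_card_fibre hx, card_slice, hm, show i + l + m - i = l + m by omega, Nat.cast_mul]
  -- sizes `a = l + t` with `t > i`: empty fibres again (`C(i, t) = 0`)
  have h3 : ∑ u ∈ range m,
      (#((slice n (l + (i + 1 + u))).filter fun ρ => edgeCount (fun e => x e || ρ e) = i + l) : ℝ) /
        #(slice n (l + (i + 1 + u))) = 0 := by
    refine sum_eq_zero fun u _ => ?_
    rw [padFibre_card_fibre hx, Nat.choose_eq_zero_of_lt (by omega : i < i + 1 + u), mul_zero, Nat.cast_zero,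
      zero_div]
  rw [show n.choose 2 + 1 = l + ((i + 1) + m) by omega, sum_range_add, sum_range_add, h1, zero_add, h3,
    add_zero, sum_congr rfl h2, padFibre_sum_choose_div, hm]
  push_cast
  ring

end

end Summit.PneNP.PneNP.Theorems.MonotoneContinuation
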